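import Summits.NavierStokesRegularity.NavierStokesRegularity.Theses.PerpetualPump
import Summits.NavierStokesRegularity.NavierStokesRegularity.Theorems.CircuitPump.Negative.LoadBearing
import Summits.NavierStokesRegularity.NavierStokesRegularity.Theorems.PerpetualPumpCircuitPumpTruncatedFlow
import Summits.NavierStokesRegularity.NavierStokesRegularity.Theorems.PerpetualPumpCircuitPumpClampCovering
import Summits.NavierStokesRegularity.NavierStokesRegularity.Theorems.PerpetualPumpCircuitPumpTruncationLimit
import Summits.NavierStokesRegularity.NavierStokesRegularity.Theorems.PerpetualPumpCircuitPumpDssExtension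
import Literature.Analysis.FluidPDE.TaoCascadeODEProofs
import HarnessLib.Audit

/-!
# Line `singular-clock-gspt` for crux `PerpetualPump.CircuitPump` (stmt-NavierStokesRegularity-1834)
# — LEAD'S RESHAPED SKELETON (prover-line-stmt-NavierStokesRegularity-1834-0, 2026-08-16)

Planner's skeleton: `Cruxes/CircuitPump/Lines/singular-clock-gspt.lean` (programme (A) of the triage panel:
k = 1 relative periodic orbit of Tao's circuit class by a u = 1 COVERING RELATION on finite truncations,
clamp trick + Brouwer/Schauder, product-topology limit, DSS unrolling). This file is the lead's work copy;
`CircuitPump_of` concludes the route decl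
`Summit.NavierStokesRegularity.NavierStokesRegularity.Theses.PerpetualPump.CircuitPump` BY NAME from the
registered stubs through the sorry-free composition `circuitPump_of_parts`.

## Reshaping done by the lead (composition idea unchanged)

* VOCABULARY. The local `rhs` is replaced by the LANDED `Theorems.CircuitPumpNegative.rhsF` (same term), and
  every `stub_*` theorem is stated FULLY UNFOLDED over Mathlib + the landed
  `Theorems.CircuitPumpNegative.{rhsF, SolvesODE, IsDSS, IsTypeI, IsNontrivial, IsSym, IsCyc}`, so that each
  stub lands as a kind = proof helper file proving the registered signature verbatim (no `def` in a stub
  file). The named `Prop`s (`InBox`, `CoveringHyp`, `ClockBox`, …) are kept for readability of the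
  composition; the glue `*_of_stub` lemmas are definitional unfoldings.
* SPLIT of the planner's stub C (`CoveringPeriodicPoint`) into C1 = `stub_truncatedFlow` (global
  existence + joint continuity of the flow of a truncated lattice system from an a-priori bound: tree
  `Literature/Analysis/ODE/GlobalExistence.lean`, Grönwall) and C2 = `stub_clampCovering` (the clamp
  trick: continuous self-map of a compact convex finite-dimensional box ⇒ fixed point ⇒ phase-matched
  relative periodic point). `ia ≠ ip` is now explicit (in `ClockBox` and in C2).
* INSTANCE of the hardest stub A (`stub_clockBox`, the lead's): the m = 2 SEEDED GRADED TODA circuit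
  (card graded-toda-soliton-pump; TRIAGE-r1-3 §A: numerically an exact-looking k = 1 DSS Type-I
  threshold orbit, `A* = M₁q/(q−1)`, `M₁ = log(c/ε)` to 0.5 %; no rotor, monotone phases, transfer gate
  with conserved `D² + 2v²`), legality to be proved here (`todaCoeff`); Tao's Table 1 (`taoCoeffOpt`, legality
  PROVED below) stays as the fallback instance. `ClockBox` is existential in `(m, coeff)`, so the choice of
  instance does not touch the other stubs.

## Registered stubs (5)

* A  `stub_clockBox` (HARDEST, lead) — fine `lam`, legal circuit, box data, `CoveringHyp` at every level `L ≥ L₀`.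
* C1 `stub_truncatedFlow` (generic ODE, size M–L) — flow of the `L`-truncated system on `[0,Tmax]` from an
  a-priori weighted bound: existence for every admissible datum, joint continuity in (datum, time).
* C2 `stub_clampCovering` (generic topology, size M–L) — flow + `CoveringHyp` ⇒ relative periodic point of the
  truncation (clamp trick + tree Schauder `Literature.Analysis.Convex.exists_fixedPoint_of_mapsTo_isCompact`).
* D  `stub_truncationLimit` (generic compactness, size M–L) — Arzelà–Ascoli + diagonal ⇒ full-lattice
  one-period relative periodic orbit.
* E  `stub_dssExtension` (generic scaling bookkeeping, size M–L) — one-period witness ⇒ the crux's object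
  (`SolvesODE ∧ IsDSS 1 ∧ IsTypeI ∧ IsNontrivial`).

Disproof used (`Cruxes/CircuitPump/Disproof.lean`, cdisprove v2, read 2026-08-16T03:30Z): no
`_false_without_` theorem; (a) load-bearing = ODE ∧ Type I ∧ nontrivial — the line uses the ODE on genuine
truncated solutions (A, C1, C2, D), Type I as the weighted bound `WBound` (A(0), D) propagated to
`C√t⋆/√(−t)` (E), nontriviality as `0 < lo ia` (A); (b) `no_free_mode`/`steady_mode_trivial`/`dss_up/down`
respected by design (truncations are approximants over ONE period; the witness is the `L → ∞` limit unrolled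
to all scales); (e3)/(f) the scalar `m = 1` chain is not used (`m = 2` Toda or `m = 4` Tao).
-/

set_option linter.dupNamespace false

noncomputable section

open Set
open scoped BigOperators

namespace Summit.NavierStokesRegularity.NavierStokesRegularity.Cruxes.CircuitPump.SingularClockGspt

variable {m : ℕ}

/-! ## The crux's objects, named (over the landed `Theorems.CircuitPumpNegative` vocabulary) -/

/-- The last four clauses of the crux for given `lam, coeff, k, X` — ODE on `(-∞,0)`, exact DSS with
period `k`, Type I in time, nontriviality — as the landed named clauses. -/
def PumpClauses (lam : ℝ) (coeff : Fin m → Fin m → Fin m → Option (Fin 3) → ℝ) (k : ℕ)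
    (X : Fin m → ℤ → ℝ → ℝ) : Prop :=
  Theorems.CircuitPumpNegative.SolvesODE lam coeff X ∧ Theorems.CircuitPumpNegative.IsDSS lam k X ∧
    Theorems.CircuitPumpNegative.IsTypeI lam X ∧ Theorems.CircuitPumpNegative.IsNontrivial X

/-! ## Lattice states, boxes, truncated flows, one-period witnesses -/

/-- BOX MEMBERSHIP of a lattice state `x : Fin m → ℤ → ℝ`: at the ACTIVE scale `n = 0` a product of
intervals `[lo i, hi i]`; at every other scale a compact convex SECTION `Q n ⊂ ℝ^m`. `Q 0` is ignored. -/
def InBox (lo hi : Fin m → ℝ) (Q : ℤ → Set (Fin m → ℝ)) (x : Fin m → ℤ → ℝ) : Prop :=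
  (∀ i : Fin m, lo i ≤ x i 0 ∧ x i 0 ≤ hi i) ∧ ∀ n : ℤ, n ≠ 0 → (fun i => x i n) ∈ Q n

/-- The state vanishes at all scales `|n| > L` (finite truncation of the bi-infinite lattice). -/
def VanishesOutside (L : ℕ) (x : Fin m → ℤ → ℝ) : Prop :=
  ∀ (i : Fin m) (n : ℤ), (L : ℤ) < |n| → x i n = 0

/-- `Z` solves the FULL lattice system on the closed window `[0, T]` (one-sided derivatives at the ends). -/
def IsSolOn (lam : ℝ) (coeff : Fin m → Fin m → Fin m → Option (Fin 3) → ℝ) (T : ℝ)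
    (Z : Fin m → ℤ → ℝ → ℝ) : Prop :=
  ∀ (i : Fin m) (n : ℤ), ∀ t ∈ Icc (0 : ℝ) T,
    HasDerivWithinAt (Z i n) (Theorems.CircuitPumpNegative.rhsF lam coeff Z i n t) (Icc (0 : ℝ) T) t

/-- `Z` is a solution on `[0, T]`, with datum `x`, of the lattice TRUNCATED to the scales `|n| ≤ L`:
modes outside are held at `0`; inside, the crux's equations hold with the outside modes read as `0`. -/
def IsTruncSolOn (L : ℕ) (lam : ℝ) (coeff : Fin m → Fin m → Fin m → Option (Fin 3) → ℝ)
    (x : Fin m → ℤ → ℝ) (T : ℝ) (Z : Fin m → ℤ → ℝ → ℝ) : Prop :=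
  (∀ (i : Fin m) (n : ℤ), Z i n 0 = x i n) ∧
  (∀ (i : Fin m) (n : ℤ), (L : ℤ) < |n| → ∀ t ∈ Icc (0 : ℝ) T, Z i n t = 0) ∧
  (∀ (i : Fin m) (n : ℤ), |n| ≤ (L : ℤ) → ∀ t ∈ Icc (0 : ℝ) T,
      HasDerivWithinAt (Z i n) (Theorems.CircuitPumpNegative.rhsF lam coeff Z i n t) (Icc (0 : ℝ) T) t)

/-- The TYPE-I WEIGHTED sup bound `lam^{3n/5}|Z_{i,n}(t)| ≤ C` on the window `[0, T]`. -/
def WBound (lam C T : ℝ) (Z : Fin m → ℤ → ℝ → ℝ) : Prop :=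
  ∀ (i : Fin m) (n : ℤ), ∀ t ∈ Icc (0 : ℝ) T, lam ^ ((3 / 5 : ℝ) * n) * |Z i n t| ≤ C

/-- A ONE-PERIOD WITNESS (relative periodic orbit of period `k = 1` modulo the scaling
`S : X ↦ lam^{1/5} X_{·,n+1}(lam^{-4/5}·)`). -/
def OnePeriodWitness (lam : ℝ) (m : ℕ) (coeff : Fin m → Fin m → Fin m → Option (Fin 3) → ℝ) :
    Prop :=
  ∃ T : ℝ, 0 < T ∧ ∃ Z : Fin m → ℤ → ℝ → ℝ, IsSolOn lam coeff T Z ∧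
    (∀ (i : Fin m) (n : ℤ), Z i (n + 1) T = lam ^ (-(1 / 5 : ℝ)) * Z i n 0) ∧
    (∃ C : ℝ, WBound lam C T Z) ∧ ∃ (i : Fin m) (n : ℤ), Z i n 0 ≠ 0

/-- The box data are sound: intervals at the active scale, compact convex nonempty sections elsewhere,
and OFF the active block `|n| < L₀` every section contains `0`. -/
def BoxOK (lo hi : Fin m → ℝ) (Q : ℤ → Set (Fin m → ℝ)) (L₀ : ℕ) : Prop :=
  (∀ i : Fin m, lo i ≤ hi i) ∧
  (∀ n : ℤ, n ≠ 0 → IsCompact (Q n) ∧ Convex ℝ (Q n) ∧ (Q n).Nonempty) ∧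
  (∀ n : ℤ, (L₀ : ℤ) < |n| → (fun _ : Fin m => (0 : ℝ)) ∈ Q n)

/-- The FLIGHT-TIME WINDOW `[T₁ A, T₂ A]` as a function of the amplitude `A ∈ [A₁, A₂]`. -/
def WindowOK (T₁ T₂ : ℝ → ℝ) (Tmin Tmax A₁ A₂ : ℝ) : Prop :=
  ContinuousOn T₁ (Icc A₁ A₂) ∧ ContinuousOn T₂ (Icc A₁ A₂) ∧ 0 < Tmin ∧
    ∀ A ∈ Icc A₁ A₂, Tmin ≤ T₁ A ∧ T₁ A ≤ T₂ A ∧ T₂ A ≤ Tmax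

/-- **THE A-PRIORI COVERING STRUCTURE of the renormalised one-period map at truncation level `L`**
(pure ODE estimates on solutions). `ia` = amplitude mode, `ip` = phase mode at the active scale. For every
box state `x` vanishing off `|n| ≤ L`: (0) A-PRIORI BOUND for every truncated solution on `[0,T'] ⊆ [0,Tmax]`;
and for truncated solutions `Z` on `[0, Tmax]` and flight times `T` in the window of `A = x_{ia,0}`:
(1) INTO (sections `Q n`, `0 < |n| ≤ L`, and the non-amplitude non-phase active coordinates); (2) AMPLITUDE
COVERING at PHASE-MATCHED times; (3) PHASE SIGNS at the two ends of the window. -/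
def CoveringHyp (lam : ℝ) (coeff : Fin m → Fin m → Fin m → Option (Fin 3) → ℝ)
    (lo hi : Fin m → ℝ) (Q : ℤ → Set (Fin m → ℝ)) (ia ip : Fin m) (T₁ T₂ : ℝ → ℝ) (C Tmax : ℝ)
    (L : ℕ) : Prop :=
  ∀ x : Fin m → ℤ → ℝ, InBox lo hi Q x → VanishesOutside L x →
    (∀ (T' : ℝ) (Z : Fin m → ℤ → ℝ → ℝ), 0 < T' → T' ≤ Tmax →
        IsTruncSolOn L lam coeff x T' Z → WBound lam C T' Z) ∧
    (∀ Z : Fin m → ℤ → ℝ → ℝ, IsTruncSolOn L lam coeff x Tmax Z →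
      (∀ T ∈ Icc (T₁ (x ia 0)) (T₂ (x ia 0)),
          (∀ n : ℤ, n ≠ 0 → |n| ≤ (L : ℤ) → (fun i => lam ^ (1 / 5 : ℝ) * Z i (n + 1) T) ∈ Q n) ∧
          (∀ i : Fin m, i ≠ ia → i ≠ ip →
              lo i ≤ lam ^ (1 / 5 : ℝ) * Z i 1 T ∧ lam ^ (1 / 5 : ℝ) * Z i 1 T ≤ hi i)) ∧
      (∀ T ∈ Icc (T₁ (x ia 0)) (T₂ (x ia 0)), lam ^ (1 / 5 : ℝ) * Z ip 1 T = x ip 0 →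
          (x ia 0 = lo ia → lam ^ (1 / 5 : ℝ) * Z ia 1 T < lo ia) ∧
          (x ia 0 = hi ia → hi ia < lam ^ (1 / 5 : ℝ) * Z ia 1 T)) ∧
      (lam ^ (1 / 5 : ℝ) * Z ip 1 (T₁ (x ia 0)) < x ip 0 ∧
        x ip 0 < lam ^ (1 / 5 : ℝ) * Z ip 1 (T₂ (x ia 0))))

/-! ## The five stub STATEMENTS as named `Prop`s (used by the composition) -/

/-- **A — THE CLOCK BOX (hardest; the only stub with circuit content).** For every `lam₀ > 1` there are a
fine `lam ∈ (1, lam₀)`, a LEGAL circuit (`m`, `coeff` symmetric + cyclic-cancelling) and BOX DATA — intervals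
`lo, hi` with AMPLITUDE WINDOW `[lo ia, hi ia] ⊂ (0,∞)`, sections `Q`, phase mode `ip ≠ ia`, flight-time
window `T₁ ≤ T₂`, weighted bound `C`, horizon `Tmax`, active block `L₀ ≥ 1` — such that `CoveringHyp` holds
at EVERY truncation level `L ≥ L₀`. Intended instance: the m = 2 seeded graded Toda circuit at fine `lam`
(see the module docstring); fallback Tao's Table 1. -/
def ClockBox : Prop :=
  ∀ lam₀ : ℝ, 1 < lam₀ → ∃ lam : ℝ, 1 < lam ∧ lam < lam₀ ∧
    ∃ (m : ℕ) (coeff : Fin m → Fin m → Fin m → Option (Fin 3) → ℝ),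
      Theorems.CircuitPumpNegative.IsSym coeff ∧ Theorems.CircuitPumpNegative.IsCyc coeff ∧
      ∃ (lo hi : Fin m → ℝ) (Q : ℤ → Set (Fin m → ℝ)) (ia ip : Fin m) (T₁ T₂ : ℝ → ℝ)
        (C Tmin Tmax : ℝ) (L₀ : ℕ),
        ia ≠ ip ∧ 1 ≤ L₀ ∧ BoxOK lo hi Q L₀ ∧ 0 < lo ia ∧ WindowOK T₁ T₂ Tmin Tmax (lo ia) (hi ia) ∧
        ∀ L : ℕ, L₀ ≤ L → CoveringHyp lam coeff lo hi Q ia ip T₁ T₂ C Tmax L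

/-- **C1 — TRUNCATED FLOW (generic ODE).** For a set `S` of data vanishing off `|n| ≤ L` on which every
truncated solution on every `[0,T'] ⊆ [0,Tmax]` obeys the weighted bound `C` (a priori), there is a flow map
`Φ : datum ↦ time ↦ state` such that `Φ x` is an `L`-truncated solution on `[0,Tmax]` from every `x ∈ S`, and
`(x, t) ↦ Φ x t` is jointly continuous on `S × [0,Tmax]` coordinatewise (product topology on data). -/
def TruncatedFlow : Prop :=
  ∀ (lam : ℝ), 1 < lam → ∀ (m : ℕ) (coeff : Fin m → Fin m → Fin m → Option (Fin 3) → ℝ)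
    (L : ℕ) (Tmax C : ℝ) (S : Set (Fin m → ℤ → ℝ)), 0 < Tmax →
    (∀ x ∈ S, VanishesOutside L x) →
    (∀ x ∈ S, ∀ (T' : ℝ) (Z : Fin m → ℤ → ℝ → ℝ), 0 < T' → T' ≤ Tmax →
        IsTruncSolOn L lam coeff x T' Z → WBound lam C T' Z) →
    ∃ Φ : (Fin m → ℤ → ℝ) → ℝ → (Fin m → ℤ → ℝ),
      (∀ x ∈ S, IsTruncSolOn L lam coeff x Tmax (fun i n t => Φ x t i n)) ∧
      (∀ (i : Fin m) (n : ℤ),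
        ContinuousOn (fun p : (Fin m → ℤ → ℝ) × ℝ => Φ p.1 p.2 i n) (S ×ˢ Icc (0 : ℝ) Tmax))

/-- **C2 — CLAMP COVERING (generic topology).** Sound box data, a window, `ia ≠ ip`, the covering structure at
level `L ≥ L₀ ≥ 1`, and a continuous truncated flow on the finite box slice ⇒ a box state `x` vanishing off
`|n| ≤ L`, a flight time in its window and a truncated solution from `x` on `[0,Tmax]`, weighted-bounded, with
RELATIVE PERIODICITY `x_{i,n} = lam^{1/5} Z_{i,n+1}(T)` for all `|n| ≤ L`. -/
def ClampCovering : Prop :=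
  ∀ (lam : ℝ), 1 < lam → ∀ (m : ℕ) (coeff : Fin m → Fin m → Fin m → Option (Fin 3) → ℝ)
    (lo hi : Fin m → ℝ) (Q : ℤ → Set (Fin m → ℝ)) (ia ip : Fin m) (T₁ T₂ : ℝ → ℝ)
    (C Tmin Tmax : ℝ) (L₀ L : ℕ),
    ia ≠ ip → 1 ≤ L₀ → L₀ ≤ L → BoxOK lo hi Q L₀ → WindowOK T₁ T₂ Tmin Tmax (lo ia) (hi ia) →
    CoveringHyp lam coeff lo hi Q ia ip T₁ T₂ C Tmax L →
    (∃ Φ : (Fin m → ℤ → ℝ) → ℝ → (Fin m → ℤ → ℝ),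
      (∀ x : Fin m → ℤ → ℝ, InBox lo hi Q x → VanishesOutside L x →
          IsTruncSolOn L lam coeff x Tmax (fun i n t => Φ x t i n)) ∧
      (∀ (i : Fin m) (n : ℤ), ContinuousOn (fun p : (Fin m → ℤ → ℝ) × ℝ => Φ p.1 p.2 i n)
          ({x | InBox lo hi Q x ∧ VanishesOutside L x} ×ˢ Icc (0 : ℝ) Tmax))) →
    ∃ (x : Fin m → ℤ → ℝ) (T : ℝ) (Z : Fin m → ℤ → ℝ → ℝ),
      InBox lo hi Q x ∧ VanishesOutside L x ∧ T ∈ Icc (T₁ (x ia 0)) (T₂ (x ia 0)) ∧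
      IsTruncSolOn L lam coeff x Tmax Z ∧ WBound lam C Tmax Z ∧
      ∀ (i : Fin m) (n : ℤ), |n| ≤ (L : ℤ) → x i n = lam ^ (1 / 5 : ℝ) * Z i (n + 1) T

/-- **C — COVERING ⇒ RELATIVE PERIODIC POINT** (the planner's stub C; here DERIVED from C1 + C2). -/
def CoveringPeriodicPoint : Prop :=
  ∀ (lam : ℝ), 1 < lam → ∀ (m : ℕ) (coeff : Fin m → Fin m → Fin m → Option (Fin 3) → ℝ)
    (lo hi : Fin m → ℝ) (Q : ℤ → Set (Fin m → ℝ)) (ia ip : Fin m) (T₁ T₂ : ℝ → ℝ)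
    (C Tmin Tmax : ℝ) (L₀ L : ℕ),
    ia ≠ ip → 1 ≤ L₀ → L₀ ≤ L → BoxOK lo hi Q L₀ → WindowOK T₁ T₂ Tmin Tmax (lo ia) (hi ia) →
    CoveringHyp lam coeff lo hi Q ia ip T₁ T₂ C Tmax L →
    ∃ (x : Fin m → ℤ → ℝ) (T : ℝ) (Z : Fin m → ℤ → ℝ → ℝ),
      InBox lo hi Q x ∧ VanishesOutside L x ∧ T ∈ Icc (T₁ (x ia 0)) (T₂ (x ia 0)) ∧
      IsTruncSolOn L lam coeff x Tmax Z ∧ WBound lam C Tmax Z ∧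
      ∀ (i : Fin m) (n : ℤ), |n| ≤ (L : ℤ) → x i n = lam ^ (1 / 5 : ℝ) * Z i (n + 1) T

/-- **D — TRUNCATION LIMIT (compactness; generic).** Relative periodic points at arbitrarily high truncation
level, flight times in a fixed `[Tmin, Tmax] ⊂ (0, ∞)`, solutions on `[0, Tmax]` with a UNIFORM weighted bound
`C`, compact sections ⇒ a one-period relative periodic orbit of the FULL lattice on `[0, Tmax]`. -/
def TruncationLimit : Prop :=
  ∀ (lam : ℝ), 1 < lam → ∀ (m : ℕ) (coeff : Fin m → Fin m → Fin m → Option (Fin 3) → ℝ)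
    (lo hi : Fin m → ℝ) (Q : ℤ → Set (Fin m → ℝ)) (C Tmin Tmax : ℝ),
    0 < Tmin → Tmin ≤ Tmax → (∀ n : ℤ, n ≠ 0 → IsCompact (Q n)) →
    (∀ L₀ : ℕ, ∃ L : ℕ, L₀ ≤ L ∧ ∃ (x : Fin m → ℤ → ℝ) (T : ℝ) (Z : Fin m → ℤ → ℝ → ℝ),
        InBox lo hi Q x ∧ T ∈ Icc Tmin Tmax ∧ IsTruncSolOn L lam coeff x Tmax Z ∧
        WBound lam C Tmax Z ∧
        ∀ (i : Fin m) (n : ℤ), |n| ≤ (L : ℤ) → x i n = lam ^ (1 / 5 : ℝ) * Z i (n + 1) T) →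
    ∃ (T : ℝ) (Z : Fin m → ℤ → ℝ → ℝ), T ∈ Icc Tmin Tmax ∧ IsSolOn lam coeff Tmax Z ∧
      WBound lam C Tmax Z ∧ InBox lo hi Q (fun i n => Z i n 0) ∧
      ∀ (i : Fin m) (n : ℤ), Z i n 0 = lam ^ (1 / 5 : ℝ) * Z i (n + 1) T

/-- **E — DSS EXTENSION (generic).** A one-period witness unrolls into the crux's object with `k = 1`. -/
def DssExtension : Prop :=
  ∀ (lam : ℝ), 1 < lam → ∀ (m : ℕ) (coeff : Fin m → Fin m → Fin m → Option (Fin 3) → ℝ),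
    OnePeriodWitness lam m coeff → ∃ X : Fin m → ℤ → ℝ → ℝ, PumpClauses lam coeff 1 X

/-! ## The five REGISTERED stubs — statements fully unfolded over Mathlib + the landed
`Summit.NavierStokesRegularity.NavierStokesRegularity.Theorems.CircuitPumpNegative` vocabulary
(`rhsF`, `SolvesODE`, `IsDSS`, `IsTypeI`, `IsNontrivial`, `IsSym`, `IsCyc`); bodies `sorry` until landed.
A stub file is `Theorems/PerpetualPumpCircuitPump<Stub>.lean`, namespace
`Summit.NavierStokesRegularity.NavierStokesRegularity.Theorems.PerpetualPumpCircuitPump`, and proves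
`theorem stub_<name> : <the signature below, verbatim>`. -/

/-- **Stub A (`ClockBox`, unfolded; the lead's).** See `ClockBox`. -/
theorem stub_clockBox :
    ∀ lam₀ : ℝ, 1 < lam₀ → ∃ lam : ℝ, 1 < lam ∧ lam < lam₀ ∧
    ∃ (m : ℕ) (coeff : Fin m → Fin m → Fin m → Option (Fin 3) → ℝ),
      Summit.NavierStokesRegularity.NavierStokesRegularity.Theorems.CircuitPumpNegative.IsSym coeff ∧
      Summit.NavierStokesRegularity.NavierStokesRegularity.Theorems.CircuitPumpNegative.IsCyc coeff ∧
      ∃ (lo hi : Fin m → ℝ) (Q : ℤ → Set (Fin m → ℝ)) (ia ip : Fin m) (T₁ T₂ : ℝ → ℝ)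
        (C Tmin Tmax : ℝ) (L₀ : ℕ),
        ia ≠ ip ∧ 1 ≤ L₀ ∧
        ((∀ i : Fin m, lo i ≤ hi i) ∧
          (∀ n : ℤ, n ≠ 0 → IsCompact (Q n) ∧ Convex ℝ (Q n) ∧ (Q n).Nonempty) ∧
          (∀ n : ℤ, (L₀ : ℤ) < |n| → (fun _ : Fin m => (0 : ℝ)) ∈ Q n)) ∧
        0 < lo ia ∧
        (ContinuousOn T₁ (Set.Icc (lo ia) (hi ia)) ∧ ContinuousOn T₂ (Set.Icc (lo ia) (hi ia)) ∧ 0 < Tmin ∧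
          ∀ A ∈ Set.Icc (lo ia) (hi ia), Tmin ≤ T₁ A ∧ T₁ A ≤ T₂ A ∧ T₂ A ≤ Tmax) ∧
        ∀ L : ℕ, L₀ ≤ L →
          ∀ x : Fin m → ℤ → ℝ,
            ((∀ i : Fin m, lo i ≤ x i 0 ∧ x i 0 ≤ hi i) ∧ ∀ n : ℤ, n ≠ 0 → (fun i => x i n) ∈ Q n) →
            (∀ (i : Fin m) (n : ℤ), (L : ℤ) < |n| → x i n = 0) →
            (∀ (T' : ℝ) (Z : Fin m → ℤ → ℝ → ℝ), 0 < T' → T' ≤ Tmax →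
                ((∀ (i : Fin m) (n : ℤ), Z i n 0 = x i n) ∧
                  (∀ (i : Fin m) (n : ℤ), (L : ℤ) < |n| → ∀ t ∈ Set.Icc (0 : ℝ) T', Z i n t = 0) ∧
                  (∀ (i : Fin m) (n : ℤ), |n| ≤ (L : ℤ) → ∀ t ∈ Set.Icc (0 : ℝ) T',
                    HasDerivWithinAt (Z i n)
                      (Summit.NavierStokesRegularity.NavierStokesRegularity.Theorems.CircuitPumpNegative.rhsF
                        lam coeff Z i n t) (Set.Icc (0 : ℝ) T') t)) →
                ∀ (i : Fin m) (n : ℤ), ∀ t ∈ Set.Icc (0 : ℝ) T', lam ^ ((3 / 5 : ℝ) * n) * |Z i n t| ≤ C) ∧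
            (∀ Z : Fin m → ℤ → ℝ → ℝ,
              ((∀ (i : Fin m) (n : ℤ), Z i n 0 = x i n) ∧
                (∀ (i : Fin m) (n : ℤ), (L : ℤ) < |n| → ∀ t ∈ Set.Icc (0 : ℝ) Tmax, Z i n t = 0) ∧
                (∀ (i : Fin m) (n : ℤ), |n| ≤ (L : ℤ) → ∀ t ∈ Set.Icc (0 : ℝ) Tmax,
                  HasDerivWithinAt (Z i n)
                    (Summit.NavierStokesRegularity.NavierStokesRegularity.Theorems.CircuitPumpNegative.rhsF
                      lam coeff Z i n t) (Set.Icc (0 : ℝ) Tmax) t)) →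
              (∀ T ∈ Set.Icc (T₁ (x ia 0)) (T₂ (x ia 0)),
                  (∀ n : ℤ, n ≠ 0 → |n| ≤ (L : ℤ) →
                    (fun i => lam ^ (1 / 5 : ℝ) * Z i (n + 1) T) ∈ Q n) ∧
                  (∀ i : Fin m, i ≠ ia → i ≠ ip →
                    lo i ≤ lam ^ (1 / 5 : ℝ) * Z i 1 T ∧ lam ^ (1 / 5 : ℝ) * Z i 1 T ≤ hi i)) ∧
              (∀ T ∈ Set.Icc (T₁ (x ia 0)) (T₂ (x ia 0)), lam ^ (1 / 5 : ℝ) * Z ip 1 T = x ip 0 →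
                  (x ia 0 = lo ia → lam ^ (1 / 5 : ℝ) * Z ia 1 T < lo ia) ∧
                  (x ia 0 = hi ia → hi ia < lam ^ (1 / 5 : ℝ) * Z ia 1 T)) ∧
              (lam ^ (1 / 5 : ℝ) * Z ip 1 (T₁ (x ia 0)) < x ip 0 ∧
                x ip 0 < lam ^ (1 / 5 : ℝ) * Z ip 1 (T₂ (x ia 0)))) := by
  sorry

/-- **Stub C1 (`TruncatedFlow`, unfolded).** WHY TRUE (size M–L): the `L`-truncated system is an autonomous
polynomial ODE on the finite-dimensional space of states vanishing off `|n| ≤ L` (transport to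
`Fin m → Fin (2L+1) → ℝ` with the sup norm); local existence/uniqueness by Picard–Lindelöf, continuation to
`[0, Tmax]` by the a-priori bound (tree `Literature/Analysis/ODE/GlobalExistence.lean`:
`ODE.exists_solution_of_apriori_bound`, `ODE.solution_extend`; or `ConfinedAutonomous.lean`), joint continuity
from Grönwall (`dist_le_of_trajectories_ODE`: the field is Lipschitz on the ball given by the a-priori bound)
plus the uniform Lipschitz bound in time. -/
theorem stub_truncatedFlow :
    ∀ (lam : ℝ), 1 < lam → ∀ (m : ℕ) (coeff : Fin m → Fin m → Fin m → Option (Fin 3) → ℝ)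
    (L : ℕ) (Tmax C : ℝ) (S : Set (Fin m → ℤ → ℝ)), 0 < Tmax →
    (∀ x ∈ S, ∀ (i : Fin m) (n : ℤ), (L : ℤ) < |n| → x i n = 0) →
    (∀ x ∈ S, ∀ (T' : ℝ) (Z : Fin m → ℤ → ℝ → ℝ), 0 < T' → T' ≤ Tmax →
        ((∀ (i : Fin m) (n : ℤ), Z i n 0 = x i n) ∧
          (∀ (i : Fin m) (n : ℤ), (L : ℤ) < |n| → ∀ t ∈ Set.Icc (0 : ℝ) T', Z i n t = 0) ∧
          (∀ (i : Fin m) (n : ℤ), |n| ≤ (L : ℤ) → ∀ t ∈ Set.Icc (0 : ℝ) T',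
            HasDerivWithinAt (Z i n)
              (Summit.NavierStokesRegularity.NavierStokesRegularity.Theorems.CircuitPumpNegative.rhsF
                lam coeff Z i n t) (Set.Icc (0 : ℝ) T') t)) →
        ∀ (i : Fin m) (n : ℤ), ∀ t ∈ Set.Icc (0 : ℝ) T', lam ^ ((3 / 5 : ℝ) * n) * |Z i n t| ≤ C) →
    ∃ Φ : (Fin m → ℤ → ℝ) → ℝ → (Fin m → ℤ → ℝ),
      (∀ x ∈ S,
        (∀ (i : Fin m) (n : ℤ), Φ x 0 i n = x i n) ∧
          (∀ (i : Fin m) (n : ℤ), (L : ℤ) < |n| → ∀ t ∈ Set.Icc (0 : ℝ) Tmax, Φ x t i n = 0) ∧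
          (∀ (i : Fin m) (n : ℤ), |n| ≤ (L : ℤ) → ∀ t ∈ Set.Icc (0 : ℝ) Tmax,
            HasDerivWithinAt (fun s => Φ x s i n)
              (Summit.NavierStokesRegularity.NavierStokesRegularity.Theorems.CircuitPumpNegative.rhsF
                lam coeff (fun i' n' s => Φ x s i' n') i n t) (Set.Icc (0 : ℝ) Tmax) t)) ∧
      (∀ (i : Fin m) (n : ℤ),
        ContinuousOn (fun p : (Fin m → ℤ → ℝ) × ℝ => Φ p.1 p.2 i n) (S ×ˢ Set.Icc (0 : ℝ) Tmax)) :=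
  Theorems.PerpetualPumpCircuitPump.stub_truncatedFlow

/-- **Stub C2 (`ClampCovering`, unfolded).** WHY TRUE (size M–L): THE CLAMP TRICK (triage r1-1). Transport the
finite box slice `N_L = {x | InBox ∧ VanishesOutside L}` to the finite-dimensional normed space
`V = Fin m → Fin (2L+1) → ℝ` (nonempty compact convex: product of `[lo i, hi i]`, the `Q n` for `0 < |n| ≤ L`
and `{0}` beyond, by `BoxOK`). On `K = N_L × [0,1]` define `F(x, θ)` by: sections `n ≠ 0` and active
non-amplitude non-phase coordinates ↦ the renormalised flow values `lam^{1/5} Φ x T (·) (n+1)`,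
`T = T₁(A) + θ (T₂(A) − T₁(A))`, `A = x_{ia,0}` (INTO by (1)); amplitude ↦ `clamp_{[lo ia, hi ia]}(2x_{ia,0} −
lam^{1/5} Φ x T ia 1)`; phase coordinate ↦ `x_{ip,0}`; `θ ↦ clamp_{[0,1]}(θ + (x_{ip,0} − lam^{1/5} Φ x T ip 1))`.
`F` is continuous `K → K` (flow continuity + `WindowOK`), so the tree's Schauder theorem
`Literature.Analysis.Convex.exists_fixedPoint_of_mapsTo_isCompact` (finite dimension: any fixed-point theorem
on compact convex sets) gives a fixed point `(x, θ)`; the `θ`-equation with the sign conditions (3) forces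
PHASE MATCHING (a clamped face value cannot be fixed); the amplitude equation `x = clamp(2x − g)` with (2)
excludes the faces and gives `g = x`; (1) and the `F`-equations give the remaining matchings; `WBound` from (0). -/
theorem stub_clampCovering :
    ∀ (lam : ℝ), 1 < lam → ∀ (m : ℕ) (coeff : Fin m → Fin m → Fin m → Option (Fin 3) → ℝ)
    (lo hi : Fin m → ℝ) (Q : ℤ → Set (Fin m → ℝ)) (ia ip : Fin m) (T₁ T₂ : ℝ → ℝ)
    (C Tmin Tmax : ℝ) (L₀ L : ℕ),
    ia ≠ ip → 1 ≤ L₀ → L₀ ≤ L →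
    ((∀ i : Fin m, lo i ≤ hi i) ∧
      (∀ n : ℤ, n ≠ 0 → IsCompact (Q n) ∧ Convex ℝ (Q n) ∧ (Q n).Nonempty) ∧
      (∀ n : ℤ, (L₀ : ℤ) < |n| → (fun _ : Fin m => (0 : ℝ)) ∈ Q n)) →
    (ContinuousOn T₁ (Set.Icc (lo ia) (hi ia)) ∧ ContinuousOn T₂ (Set.Icc (lo ia) (hi ia)) ∧ 0 < Tmin ∧
      ∀ A ∈ Set.Icc (lo ia) (hi ia), Tmin ≤ T₁ A ∧ T₁ A ≤ T₂ A ∧ T₂ A ≤ Tmax) →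
    (∀ x : Fin m → ℤ → ℝ,
      ((∀ i : Fin m, lo i ≤ x i 0 ∧ x i 0 ≤ hi i) ∧ ∀ n : ℤ, n ≠ 0 → (fun i => x i n) ∈ Q n) →
      (∀ (i : Fin m) (n : ℤ), (L : ℤ) < |n| → x i n = 0) →
      (∀ (T' : ℝ) (Z : Fin m → ℤ → ℝ → ℝ), 0 < T' → T' ≤ Tmax →
          ((∀ (i : Fin m) (n : ℤ), Z i n 0 = x i n) ∧
            (∀ (i : Fin m) (n : ℤ), (L : ℤ) < |n| → ∀ t ∈ Set.Icc (0 : ℝ) T', Z i n t = 0) ∧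
            (∀ (i : Fin m) (n : ℤ), |n| ≤ (L : ℤ) → ∀ t ∈ Set.Icc (0 : ℝ) T',
              HasDerivWithinAt (Z i n)
                (Summit.NavierStokesRegularity.NavierStokesRegularity.Theorems.CircuitPumpNegative.rhsF
                  lam coeff Z i n t) (Set.Icc (0 : ℝ) T') t)) →
          ∀ (i : Fin m) (n : ℤ), ∀ t ∈ Set.Icc (0 : ℝ) T', lam ^ ((3 / 5 : ℝ) * n) * |Z i n t| ≤ C) ∧
      (∀ Z : Fin m → ℤ → ℝ → ℝ,
        ((∀ (i : Fin m) (n : ℤ), Z i n 0 = x i n) ∧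
          (∀ (i : Fin m) (n : ℤ), (L : ℤ) < |n| → ∀ t ∈ Set.Icc (0 : ℝ) Tmax, Z i n t = 0) ∧
          (∀ (i : Fin m) (n : ℤ), |n| ≤ (L : ℤ) → ∀ t ∈ Set.Icc (0 : ℝ) Tmax,
            HasDerivWithinAt (Z i n)
              (Summit.NavierStokesRegularity.NavierStokesRegularity.Theorems.CircuitPumpNegative.rhsF
                lam coeff Z i n t) (Set.Icc (0 : ℝ) Tmax) t)) →
        (∀ T ∈ Set.Icc (T₁ (x ia 0)) (T₂ (x ia 0)),
            (∀ n : ℤ, n ≠ 0 → |n| ≤ (L : ℤ) → (fun i => lam ^ (1 / 5 : ℝ) * Z i (n + 1) T) ∈ Q n) ∧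
            (∀ i : Fin m, i ≠ ia → i ≠ ip →
              lo i ≤ lam ^ (1 / 5 : ℝ) * Z i 1 T ∧ lam ^ (1 / 5 : ℝ) * Z i 1 T ≤ hi i)) ∧
        (∀ T ∈ Set.Icc (T₁ (x ia 0)) (T₂ (x ia 0)), lam ^ (1 / 5 : ℝ) * Z ip 1 T = x ip 0 →
            (x ia 0 = lo ia → lam ^ (1 / 5 : ℝ) * Z ia 1 T < lo ia) ∧
            (x ia 0 = hi ia → hi ia < lam ^ (1 / 5 : ℝ) * Z ia 1 T)) ∧
        (lam ^ (1 / 5 : ℝ) * Z ip 1 (T₁ (x ia 0)) < x ip 0 ∧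
          x ip 0 < lam ^ (1 / 5 : ℝ) * Z ip 1 (T₂ (x ia 0))))) →
    (∃ Φ : (Fin m → ℤ → ℝ) → ℝ → (Fin m → ℤ → ℝ),
      (∀ x : Fin m → ℤ → ℝ,
        ((∀ i : Fin m, lo i ≤ x i 0 ∧ x i 0 ≤ hi i) ∧ ∀ n : ℤ, n ≠ 0 → (fun i => x i n) ∈ Q n) →
        (∀ (i : Fin m) (n : ℤ), (L : ℤ) < |n| → x i n = 0) →
        (∀ (i : Fin m) (n : ℤ), Φ x 0 i n = x i n) ∧
          (∀ (i : Fin m) (n : ℤ), (L : ℤ) < |n| → ∀ t ∈ Set.Icc (0 : ℝ) Tmax, Φ x t i n = 0) ∧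
          (∀ (i : Fin m) (n : ℤ), |n| ≤ (L : ℤ) → ∀ t ∈ Set.Icc (0 : ℝ) Tmax,
            HasDerivWithinAt (fun s => Φ x s i n)
              (Summit.NavierStokesRegularity.NavierStokesRegularity.Theorems.CircuitPumpNegative.rhsF
                lam coeff (fun i' n' s => Φ x s i' n') i n t) (Set.Icc (0 : ℝ) Tmax) t)) ∧
      (∀ (i : Fin m) (n : ℤ), ContinuousOn (fun p : (Fin m → ℤ → ℝ) × ℝ => Φ p.1 p.2 i n)
        ({x : Fin m → ℤ → ℝ |
            ((∀ i : Fin m, lo i ≤ x i 0 ∧ x i 0 ≤ hi i) ∧ ∀ n : ℤ, n ≠ 0 → (fun i => x i n) ∈ Q n) ∧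
            ∀ (i : Fin m) (n : ℤ), (L : ℤ) < |n| → x i n = 0} ×ˢ Set.Icc (0 : ℝ) Tmax))) →
    ∃ (x : Fin m → ℤ → ℝ) (T : ℝ) (Z : Fin m → ℤ → ℝ → ℝ),
      ((∀ i : Fin m, lo i ≤ x i 0 ∧ x i 0 ≤ hi i) ∧ ∀ n : ℤ, n ≠ 0 → (fun i => x i n) ∈ Q n) ∧
      (∀ (i : Fin m) (n : ℤ), (L : ℤ) < |n| → x i n = 0) ∧
      T ∈ Set.Icc (T₁ (x ia 0)) (T₂ (x ia 0)) ∧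
      ((∀ (i : Fin m) (n : ℤ), Z i n 0 = x i n) ∧
        (∀ (i : Fin m) (n : ℤ), (L : ℤ) < |n| → ∀ t ∈ Set.Icc (0 : ℝ) Tmax, Z i n t = 0) ∧
        (∀ (i : Fin m) (n : ℤ), |n| ≤ (L : ℤ) → ∀ t ∈ Set.Icc (0 : ℝ) Tmax,
          HasDerivWithinAt (Z i n)
            (Summit.NavierStokesRegularity.NavierStokesRegularity.Theorems.CircuitPumpNegative.rhsF
              lam coeff Z i n t) (Set.Icc (0 : ℝ) Tmax) t)) ∧
      (∀ (i : Fin m) (n : ℤ), ∀ t ∈ Set.Icc (0 : ℝ) Tmax, lam ^ ((3 / 5 : ℝ) * n) * |Z i n t| ≤ C) ∧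
      ∀ (i : Fin m) (n : ℤ), |n| ≤ (L : ℤ) → x i n = lam ^ (1 / 5 : ℝ) * Z i (n + 1) T :=
  Theorems.PerpetualPumpCircuitPump.stub_clampCovering

/-- **Stub D (`TruncationLimit`, unfolded).** WHY TRUE (size M–L): coordinatewise the truncated solutions are
uniformly bounded (`|Z_{i,n}| ≤ C lam^{-3n/5}`) and equi-Lipschitz on `[0,Tmax]` (for `|n| ≤ L` the derivative is
`rhsF`, a finite sum over the neighbours `n, n ± 1`, bounded uniformly in the level; for `|n| > L` the mode is
`0`); Arzelà–Ascoli in each of the countably many coordinates + a diagonal subsequence (or compactness of the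
countable product `isCompact_univ_pi` + first countability), `T_L → T`; the limit satisfies the integral form of
the equations (finite sums pass to the uniform limit), hence `HasDerivWithinAt` on `[0, Tmax]`
(`intervalIntegral.integral_hasDerivWithinAt_right`); closed sections/intervals and the matching identity pass
to the limit by uniform convergence + equicontinuity. -/
theorem stub_truncationLimit :
    ∀ (lam : ℝ), 1 < lam → ∀ (m : ℕ) (coeff : Fin m → Fin m → Fin m → Option (Fin 3) → ℝ)
    (lo hi : Fin m → ℝ) (Q : ℤ → Set (Fin m → ℝ)) (C Tmin Tmax : ℝ),
    0 < Tmin → Tmin ≤ Tmax → (∀ n : ℤ, n ≠ 0 → IsCompact (Q n)) →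
    (∀ L₀ : ℕ, ∃ L : ℕ, L₀ ≤ L ∧ ∃ (x : Fin m → ℤ → ℝ) (T : ℝ) (Z : Fin m → ℤ → ℝ → ℝ),
        ((∀ i : Fin m, lo i ≤ x i 0 ∧ x i 0 ≤ hi i) ∧ ∀ n : ℤ, n ≠ 0 → (fun i => x i n) ∈ Q n) ∧
        T ∈ Set.Icc Tmin Tmax ∧
        ((∀ (i : Fin m) (n : ℤ), Z i n 0 = x i n) ∧
          (∀ (i : Fin m) (n : ℤ), (L : ℤ) < |n| → ∀ t ∈ Set.Icc (0 : ℝ) Tmax, Z i n t = 0) ∧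
          (∀ (i : Fin m) (n : ℤ), |n| ≤ (L : ℤ) → ∀ t ∈ Set.Icc (0 : ℝ) Tmax,
            HasDerivWithinAt (Z i n)
              (Summit.NavierStokesRegularity.NavierStokesRegularity.Theorems.CircuitPumpNegative.rhsF
                lam coeff Z i n t) (Set.Icc (0 : ℝ) Tmax) t)) ∧
        (∀ (i : Fin m) (n : ℤ), ∀ t ∈ Set.Icc (0 : ℝ) Tmax, lam ^ ((3 / 5 : ℝ) * n) * |Z i n t| ≤ C) ∧
        ∀ (i : Fin m) (n : ℤ), |n| ≤ (L : ℤ) → x i n = lam ^ (1 / 5 : ℝ) * Z i (n + 1) T) →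
    ∃ (T : ℝ) (Z : Fin m → ℤ → ℝ → ℝ), T ∈ Set.Icc Tmin Tmax ∧
      (∀ (i : Fin m) (n : ℤ), ∀ t ∈ Set.Icc (0 : ℝ) Tmax,
        HasDerivWithinAt (Z i n)
          (Summit.NavierStokesRegularity.NavierStokesRegularity.Theorems.CircuitPumpNegative.rhsF
            lam coeff Z i n t) (Set.Icc (0 : ℝ) Tmax) t) ∧
      (∀ (i : Fin m) (n : ℤ), ∀ t ∈ Set.Icc (0 : ℝ) Tmax, lam ^ ((3 / 5 : ℝ) * n) * |Z i n t| ≤ C) ∧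
      ((∀ i : Fin m, lo i ≤ Z i 0 0 ∧ Z i 0 0 ≤ hi i) ∧ ∀ n : ℤ, n ≠ 0 → (fun i => Z i n 0) ∈ Q n) ∧
      ∀ (i : Fin m) (n : ℤ), Z i n 0 = lam ^ (1 / 5 : ℝ) * Z i (n + 1) T :=
  Theorems.PerpetualPumpCircuitPump.stub_truncationLimit

/-- **Stub E (`DssExtension`, unfolded).** WHY TRUE (size M–L): shift time so that the blow-up time is `0` —
`t⋆ = T/(1 − lam^{-4/5})`, `s₀ = −t⋆`; the windows `W_j = [lam^{-4j/5}s₀, lam^{-4(j+1)/5}s₀]`, `j ∈ ℤ`, tile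
`(−∞, 0)`; put `X_{i,n}(t) = lam^{-j/5} Z_{i,n−j}(lam^{4j/5}t − s₀)` on `W_j` — the SCALING SYMMETRY of class
(4.3) (`X ↦ lam^{1/5}X_{·,n+1}(lam^{-4/5}·)` maps solutions to solutions; cf. the landed `freeX_dss`, `dss_up`,
`dss_down`) makes each piece a solution, the period relation makes the junctions continuous and the two
one-sided derivatives there both equal `rhsF` of the common state, so `HasDerivAt` holds on all of `(−∞,0)`;
DSS with `k = 1` by construction; TYPE I: on `W_j`, `lam^{3n/5}|X_{i,n}(t)| ≤ C lam^{2j/5} ≤ C√t⋆/√(−t)`;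
nontrivial at `t = s₀`. Mathlib: `Real.rpow_add/_mul/_intCast`, `Int.floor`/`Real.logb` (locate `j`),
`HasDerivWithinAt.union` / `hasDerivAt_iff ...` (junction gluing). -/
theorem stub_dssExtension :
    ∀ (lam : ℝ), 1 < lam → ∀ (m : ℕ) (coeff : Fin m → Fin m → Fin m → Option (Fin 3) → ℝ)
    (T : ℝ) (Z : Fin m → ℤ → ℝ → ℝ), 0 < T →
    (∀ (i : Fin m) (n : ℤ), ∀ t ∈ Set.Icc (0 : ℝ) T,
      HasDerivWithinAt (Z i n)
        (Summit.NavierStokesRegularity.NavierStokesRegularity.Theorems.CircuitPumpNegative.rhsF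
          lam coeff Z i n t) (Set.Icc (0 : ℝ) T) t) →
    (∀ (i : Fin m) (n : ℤ), Z i (n + 1) T = lam ^ (-(1 / 5 : ℝ)) * Z i n 0) →
    (∃ C : ℝ, ∀ (i : Fin m) (n : ℤ), ∀ t ∈ Set.Icc (0 : ℝ) T, lam ^ ((3 / 5 : ℝ) * n) * |Z i n t| ≤ C) →
    (∃ (i : Fin m) (n : ℤ), Z i n 0 ≠ 0) →
    ∃ X : Fin m → ℤ → ℝ → ℝ,
      Summit.NavierStokesRegularity.NavierStokesRegularity.Theorems.CircuitPumpNegative.SolvesODE lam coeff X ∧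
      Summit.NavierStokesRegularity.NavierStokesRegularity.Theorems.CircuitPumpNegative.IsDSS lam 1 X ∧
      Summit.NavierStokesRegularity.NavierStokesRegularity.Theorems.CircuitPumpNegative.IsTypeI lam X ∧
      Summit.NavierStokesRegularity.NavierStokesRegularity.Theorems.CircuitPumpNegative.IsNontrivial X :=
  Theorems.PerpetualPumpCircuitPump.stub_dssExtension

/-! ## Glue: the named statements from the registered stubs (definitional unfolding) -/

theorem clockBox_of_stub : ClockBox := stub_clockBox

theorem truncatedFlow_of_stub : TruncatedFlow := by
  intro lam hlam m coeff L Tmax C S hT hS hap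
  exact stub_truncatedFlow lam hlam m coeff L Tmax C S hT hS hap

theorem clampCovering_of_stub : ClampCovering := by
  intro lam hlam m coeff lo hi Q ia ip T₁ T₂ C Tmin Tmax L₀ L hip hL₀ hL hbox hwin hcov hflow
  exact stub_clampCovering lam hlam m coeff lo hi Q ia ip T₁ T₂ C Tmin Tmax L₀ L hip hL₀ hL hbox hwin hcov
    hflow

theorem truncationLimit_of_stub : TruncationLimit := by
  intro lam hlam m coeff lo hi Q C Tmin Tmax hTmin hTT hQ hper
  exact stub_truncationLimit lam hlam m coeff lo hi Q C Tmin Tmax hTmin hTT hQ hper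

theorem dssExtension_of_stub : DssExtension := by
  intro lam hlam m coeff hW
  obtain ⟨T, hT, Z, hsol, hmatch, hwb, hnz⟩ := hW
  exact stub_dssExtension lam hlam m coeff T Z hT hsol hmatch hwb hnz

/-- **C from C1 + C2**: instantiate the truncated flow on the finite box slice (its a-priori bound is
clause (0) of `CoveringHyp`) and feed it to the clamp covering. -/
theorem coveringPeriodicPoint_of (hC1 : TruncatedFlow) (hC2 : ClampCovering) : CoveringPeriodicPoint := by
  intro lam hlam m coeff lo hi Q ia ip T₁ T₂ C Tmin Tmax L₀ L hip hL₀ hL hbox hwin hcov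
  have hTmax : 0 < Tmax := by
    obtain ⟨-, -, hTmin, hA⟩ := hwin
    obtain ⟨h1, h2, h3⟩ := hA (lo ia) ⟨le_rfl, hbox.1 ia⟩
    linarith
  obtain ⟨Φ, hsol, hcont⟩ := hC1 lam hlam m coeff L Tmax C {x | InBox lo hi Q x ∧ VanishesOutside L x}
    hTmax (fun x hx => hx.2) (fun x hx T' Z hT' hle hZ => (hcov x hx.1 hx.2).1 T' Z hT' hle hZ)
  exact hC2 lam hlam m coeff lo hi Q ia ip T₁ T₂ C Tmin Tmax L₀ L hip hL₀ hL hbox hwin hcov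
    ⟨Φ, fun x hx hv => hsol x ⟨hx, hv⟩, hcont⟩


/-! ## The singular clock (PROVED): quiet phase, fuse, ignition, affine return map, faces -/

/-- **Quiet phase, explicit.** With damping `ν` and checkpoint amplitude `A`, the damped carrier
`a(t) = Ae^{-νt}` and the fuse variable `b(t) = εA²(e^{-νt} - e^{-2νt})/ν` solve the quiet-phase
equations `ȧ = -νa`, `ḃ = εa² - νb` (the `a, b` rows of Tao's (6.1)–(6.2) with the amplifier `c` and the
output `d` still dormant, dissipation kept EXACT). [folklore] -/
theorem quietPhase_hasDerivAt (ν ε A t : ℝ) (hν : ν ≠ 0) :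
    HasDerivAt (fun s => A * Real.exp (-ν * s)) (-ν * (A * Real.exp (-ν * t))) t ∧
    HasDerivAt (fun s => ε * A ^ 2 / ν * (Real.exp (-ν * s) - Real.exp (-2 * ν * s)))
      (ε * (A * Real.exp (-ν * t)) ^ 2 -
        ν * (ε * A ^ 2 / ν * (Real.exp (-ν * t) - Real.exp (-2 * ν * t)))) t := by
  have h2 : Real.exp (-ν * t) ^ 2 = Real.exp (-2 * ν * t) := by
    rw [sq, ← Real.exp_add]; ring_nf
  constructor
  · have h := (((hasDerivAt_id t).const_mul (-ν)).exp).const_mul A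
    refine h.congr_deriv ?_
    simp only [id]
    ring
  · have h := ((((hasDerivAt_id t).const_mul (-ν)).exp).sub
      (((hasDerivAt_id t).const_mul (-2 * ν)).exp)).const_mul (ε * A ^ 2 / ν)
    refine h.congr_deriv ?_
    simp only [id]
    rw [mul_pow, h2]
    field_simp
    ring

/-- **The fuse.** The amplifier's accumulated gain exponent `κ∫₀ᵗ b` (`κ = ε⁻¹K¹⁰` for Tao's Table 1)
along the quiet phase is `κεA²(1 - e^{-νt})²/(2ν²)` — the ENTRY in the singular clock: ignition
(`= log(ignition/seed) ≈ K¹⁰`) happens when `A(1 - e^{-νt}) = √2·ν`. [folklore] -/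
theorem fuse_integral (ν ε κ A t : ℝ) (hν : ν ≠ 0) :
    ∫ s in (0:ℝ)..t, κ * (ε * A ^ 2 / ν * (Real.exp (-ν * s) - Real.exp (-2 * ν * s))) =
      κ * ε * A ^ 2 * (1 - Real.exp (-ν * t)) ^ 2 / (2 * ν ^ 2) := by
  have hderiv : ∀ s ∈ uIcc (0:ℝ) t,
      HasDerivAt (fun s => κ * ε * A ^ 2 * (1 - Real.exp (-ν * s)) ^ 2 / (2 * ν ^ 2))
        (κ * (ε * A ^ 2 / ν * (Real.exp (-ν * s) - Real.exp (-2 * ν * s)))) s := by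
    intro s _
    have h1 : HasDerivAt (fun s => 1 - Real.exp (-ν * s)) (0 - Real.exp (-ν * s) * (-ν * 1)) s :=
      (hasDerivAt_const s (1:ℝ)).sub (((hasDerivAt_id s).const_mul (-ν)).exp)
    have h3 := ((h1.pow 2).const_mul (κ * ε * A ^ 2)).div_const (2 * ν ^ 2)
    refine h3.congr_deriv ?_
    have h2 : Real.exp (-ν * s) ^ 2 = Real.exp (-2 * ν * s) := by
      rw [sq, ← Real.exp_add]; ring_nf
    rw [← h2]
    field_simp
    ring
  have hint : IntervalIntegrable
      (fun s => κ * (ε * A ^ 2 / ν * (Real.exp (-ν * s) - Real.exp (-2 * ν * s))))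
      MeasureTheory.volume 0 t := by
    apply Continuous.intervalIntegrable
    fun_prop
  rw [intervalIntegral.integral_eq_sub_of_hasDerivAt hderiv hint]
  norm_num

/-- **Ignition amplitude.** When the fuse condition `(A(1 - e^{-ντ}))² = M²` is met (`M = √2·ν` for
Tao's clock, `M = M₁` for a seed clock), the damped carrier has amplitude EXACTLY `A - M`: the hand-over
to the next scale is AFFINE in `A`. [folklore] -/
theorem ignition_amplitude (ν A τ M : ℝ)
    (h : (A * (1 - Real.exp (-ν * τ))) ^ 2 = M ^ 2)
    (hpos : 0 ≤ A * (1 - Real.exp (-ν * τ))) (hM : 0 ≤ M) :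
    A * Real.exp (-ν * τ) = A - M := by
  have h3 : A * (1 - Real.exp (-ν * τ)) = M := (pow_left_inj₀ hpos hM two_ne_zero).1 h
  linarith [h3]

/-- The AFFINE SINGULAR RETURN MAP of the clock in critical units: `g(A) = q(A - M)` (energy-preserving
hand-over of the carrier `A - M` to the next scale, critical rescaling `q = lam^{1/5}`; `M = √2` for
Tao's circuit at scale-`0` raw normalisation). -/
def clockMap (q M A : ℝ) : ℝ := q * (A - M)

/-- Its unique fixed point `A⋆ = Mq/(q-1)` (`≈ 2√2/ε₀` for Tao's circuit at fine `lam`). -/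
def clockFix (q M : ℝ) : ℝ := M * q / (q - 1)

/-- `A⋆` is a fixed point of the clock map. [folklore] -/
theorem clockMap_clockFix {q : ℝ} (hq : 1 < q) (M : ℝ) :
    clockMap q M (clockFix q M) = clockFix q M := by
  unfold clockMap clockFix
  have : q - 1 ≠ 0 := by linarith
  field_simp
  ring

/-- The clock map is affine with slope `q > 1` about `A⋆`: the amplitude is the (unique) REPELLING
direction, multiplier `q = lam^{1/5}`. [folklore] -/
theorem clockMap_sub_clockFix {q : ℝ} (hq : 1 < q) (M A : ℝ) :
    clockMap q M A - clockFix q M = q * (A - clockFix q M) := by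
  unfold clockMap clockFix
  have : q - 1 ≠ 0 := by linarith
  field_simp
  ring

/-- **The Type-I DSS law as an identity**: at threshold the carrier loses exactly the fraction `M/A⋆`
per period and `1 - M/A⋆ = q⁻¹ = lam^{-1/5}` on the nose. [folklore] -/
theorem one_sub_div_clockFix {q M : ℝ} (hq : 1 < q) (hM : M ≠ 0) : 1 - M / clockFix q M = q⁻¹ := by
  unfold clockFix
  have h1 : q - 1 ≠ 0 := by linarith
  have h2 : q ≠ 0 := by linarith
  field_simp
  ring

/-- `A⋆ > M`: the threshold datum does ignite. [folklore] -/
theorem lt_clockFix {q M : ℝ} (hq : 1 < q) (hM : 0 < M) : M < clockFix q M := by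
  unfold clockFix
  rw [lt_div_iff₀ (by linarith)]
  nlinarith

/-- `A⋆ > 0`. [folklore] -/
theorem clockFix_pos {q M : ℝ} (hq : 1 < q) (hM : 0 < M) : 0 < clockFix q M := by
  unfold clockFix
  exact div_pos (by positivity) (by linarith)

/-- Lower face of the amplitude window: `g(A⋆/2) = (A⋆/2)(2 - q)`. [folklore] -/
theorem clockMap_half {q : ℝ} (hq : 1 < q) (M : ℝ) :
    clockMap q M (clockFix q M / 2) = (clockFix q M / 2) * (2 - q) := by
  unfold clockMap clockFix
  have : q - 1 ≠ 0 := by linarith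
  field_simp
  ring

/-- Upper face of the amplitude window: `g(2A⋆) = 2A⋆·(1 + q)/2`. [folklore] -/
theorem clockMap_double {q : ℝ} (hq : 1 < q) (M : ℝ) :
    clockMap q M (2 * clockFix q M) = (2 * clockFix q M) * ((1 + q) / 2) := by
  unfold clockMap clockFix
  have : q - 1 ≠ 0 := by linarith
  field_simp
  ring

/-- **LOWER FACE COVERING with error allowance** `(q-1)/4` (relative): any next amplitude within that
allowance of the clock value at `A = A⋆/2` lies strictly BELOW `A⋆/2` — the shape of hypothesis (2) of
`CoveringHyp` at `lo ia = A⋆/2`; the allowance `≈ ε₀/8` dominates the clock errors `O(ε₀K^{-1/4})`.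
[folklore] -/
theorem lower_face {q M g : ℝ} (hq : 1 < q) (hM : 0 < M)
    (hg : g ≤ clockMap q M (clockFix q M / 2) + (q - 1) / 4 * (clockFix q M / 2)) :
    g < clockFix q M / 2 := by
  rw [clockMap_half hq M] at hg
  have hA : 0 < clockFix q M := clockFix_pos hq hM
  nlinarith

/-- **UPPER FACE COVERING with error allowance** `(q-1)/4`: strictly ABOVE `2A⋆`. [folklore] -/
theorem upper_face {q M g : ℝ} (hq : 1 < q) (hM : 0 < M)
    (hg : clockMap q M (2 * clockFix q M) - (q - 1) / 4 * (2 * clockFix q M) ≤ g) :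
    2 * clockFix q M < g := by
  rw [clockMap_double hq M] at hg
  have hA : 0 < clockFix q M := clockFix_pos hq hM
  nlinarith

/-! ## The intended instance of `ClockBox` is legal (PROVED): Tao's Table 1, fine `lam` -/

/-- Tao's fine scale ratio `lam = (1+ε₀)^{5/2}` (`lam^{4/5} = (1+ε₀)²` dissipation ratio, `lam` coupling
ratio, `q = lam^{1/5} = (1+ε₀)^{1/2}`). -/
def taoLam (ε₀ : ℝ) : ℝ := (1 + ε₀) ^ ((5 : ℝ) / 2)

/-- `lam > 1` for `ε₀ > 0`. [folklore] -/
theorem one_lt_taoLam {ε₀ : ℝ} (h : 0 < ε₀) : 1 < taoLam ε₀ :=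
  Real.one_lt_rpow (by linarith) (by norm_num)

/-- FINE `lam` IS AVAILABLE: for every `lam₀ > 1` some `ε₀ > 0` has `1 < taoLam ε₀ < lam₀` (the crux's
`∀ lam₀ ∃ lam ∈ (1, lam₀)` prefix, for the intended instance). [folklore] -/
theorem exists_taoLam_lt {lam₀ : ℝ} (h : 1 < lam₀) :
    ∃ ε₀ : ℝ, 0 < ε₀ ∧ 1 < taoLam ε₀ ∧ taoLam ε₀ < lam₀ := by
  set ε₀ : ℝ := min 1 ((lam₀ - 1) / 8) with hε₀
  have hpos : 0 < ε₀ := lt_min one_pos (by linarith)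
  have hle1 : ε₀ ≤ 1 := min_le_left _ _
  have hle2 : ε₀ ≤ (lam₀ - 1) / 8 := min_le_right _ _
  refine ⟨ε₀, hpos, one_lt_taoLam hpos, ?_⟩
  have hbase : (1 : ℝ) ≤ 1 + ε₀ := by linarith
  have h1 : taoLam ε₀ ≤ (1 + ε₀) ^ ((3 : ℕ) : ℝ) :=
    Real.rpow_le_rpow_of_exponent_le hbase (by norm_num)
  rw [Real.rpow_natCast] at h1
  have hsq : ε₀ ^ 2 ≤ ε₀ := by nlinarith
  have hcube : ε₀ ^ 3 ≤ ε₀ := by nlinarith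
  have h3 : (1 + ε₀) ^ 3 = 1 + 3 * ε₀ + 3 * ε₀ ^ 2 + ε₀ ^ 3 := by ring
  linarith

/-- Tao's offset labels as points of the tree's shift set `S ⊂ ℤ³` (`none = (0,0,0)`, `some j = e_{j+1}`;
cf. `TaoCascade.shiftSet`). -/
def optShift (μ : Option (Fin 3)) : ℤ × ℤ × ℤ :=
  ((if μ = some 0 then 1 else 0), (if μ = some 1 then 1 else 0), (if μ = some 2 then 1 else 0))

/-- TAO'S TABLE-1 STRUCTURE CONSTANTS (`m = 4`; tree `TaoCascade.taoCoeff`, with the tree's correction of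
the two misprinted entries) in the crux's `Option (Fin 3)` encoding (as in
`Lines/declocking-continuation.lean`). Modes `0,1,2,3 = a,b,c,d`. -/
def taoCoeffOpt (ε₀ K ε : ℝ) (a b c : Fin 4) (μ : Option (Fin 3)) : ℝ :=
  Literature.Analysis.FluidPDE.TaoCascade.taoCoeff ε₀ K ε a b c (optShift μ)

/-- The six permutations of `Fin 3`, for sums over `Equiv.Perm (Fin 3)`. [folklore] -/
theorem sum_perm_fin_three {M : Type*} [AddCommMonoid M] (g : Equiv.Perm (Fin 3) → M) :
    ∑ σ : Equiv.Perm (Fin 3), g σ =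
      g 1 + g (Equiv.swap 0 1) + g (Equiv.swap 0 2) + g (Equiv.swap 1 2) +
        g (Equiv.swap 0 1 * Equiv.swap 1 2) + g (Equiv.swap 1 2 * Equiv.swap 0 1) := by
  have h : (Finset.univ : Finset (Equiv.Perm (Fin 3))) =
      {1, Equiv.swap 0 1, Equiv.swap 0 2, Equiv.swap 1 2, Equiv.swap 0 1 * Equiv.swap 1 2,
        Equiv.swap 1 2 * Equiv.swap 0 1} := by decide
  rw [h]
  rw [Finset.sum_insert (by decide), Finset.sum_insert (by decide), Finset.sum_insert (by decide),
    Finset.sum_insert (by decide), Finset.sum_insert (by decide), Finset.sum_singleton]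
  abel

open Literature.Analysis.FluidPDE TaoCascade in
/-- **Table 1 is symmetric (4.2) in the crux encoding**: `IsSym (taoCoeffOpt ε₀ K ε)` (from the tree's
`TaoCascade.taoCoeff_symmetric`). [cite: Tao2016AveragedNS, §6.1 Table 1, (4.2)] -/
theorem isSym_taoCoeffOpt (ε₀ K ε : ℝ) : Theorems.CircuitPumpNegative.IsSym (taoCoeffOpt ε₀ K ε) := by
  intro i₁ i₂ i₃ μ
  have hS := taoCoeff_symmetric ε₀ K ε
  rcases μ with _ | j
  · simpa [taoCoeffOpt, optShift] using hS i₁ i₂ i₃ 0 0 0 (by simp [mem_shiftSet_iff])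
  · fin_cases j
    · simpa [taoCoeffOpt, optShift] using hS i₁ i₂ i₃ 1 0 0 (by simp [mem_shiftSet_iff])
    · simpa [taoCoeffOpt, optShift] using hS i₁ i₂ i₃ 0 1 0 (by simp [mem_shiftSet_iff])
    · simpa [taoCoeffOpt, optShift, Equiv.swap_apply_of_ne_of_ne] using
        hS i₁ i₂ i₃ 0 0 1 (by simp [mem_shiftSet_iff])

open Literature.Analysis.FluidPDE TaoCascade in
/-- **Table 1 is cyclic-cancelling (4.3) in the crux encoding**: `IsCyc (taoCoeffOpt ε₀ K ε)` (from the
tree's `TaoCascade.taoCoeff_cancelling`; the permutation `σ` relabels the slots and moves the raised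
slot to `σ⁻¹ j`). [cite: Tao2016AveragedNS, §6.1 Table 1, (4.3)] -/
theorem isCyc_taoCoeffOpt (ε₀ K ε : ℝ) : Theorems.CircuitPumpNegative.IsCyc (taoCoeffOpt ε₀ K ε) := by
  intro v μ
  have hC := taoCoeff_cancelling ε₀ K ε
  have hc1 : (Equiv.swap (0 : Fin 3) 1 * Equiv.swap 1 2).symm = Equiv.swap 1 2 * Equiv.swap 0 1 := by
    decide
  have hc2 : (Equiv.swap (1 : Fin 3) 2 * Equiv.swap 0 1).symm = Equiv.swap 0 1 * Equiv.swap 1 2 := by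
    decide
  have h1 : (1 : Equiv.Perm (Fin 3)).symm = 1 := by decide
  rw [sum_perm_fin_three]
  rcases μ with _ | j
  · have := hC (v 0) (v 1) (v 2) 0 0 0 (by simp [mem_shiftSet_iff])
    simp [taoCoeffOpt, optShift, Equiv.Perm.mul_apply, Equiv.swap_apply_of_ne_of_ne,
      Equiv.swap_apply_left, Equiv.swap_apply_right] at this ⊢
    linear_combination this
  · fin_cases j
    · have := hC (v 0) (v 1) (v 2) 1 0 0 (by simp [mem_shiftSet_iff])
      simp [taoCoeffOpt, optShift, Equiv.Perm.mul_apply, Equiv.swap_apply_of_ne_of_ne,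
        Equiv.swap_apply_left, Equiv.swap_apply_right, Equiv.symm_swap, hc1, hc2, h1] at this ⊢
      linear_combination this
    · have := hC (v 0) (v 1) (v 2) 0 1 0 (by simp [mem_shiftSet_iff])
      simp [taoCoeffOpt, optShift, Equiv.Perm.mul_apply, Equiv.swap_apply_of_ne_of_ne,
        Equiv.swap_apply_left, Equiv.swap_apply_right, Equiv.symm_swap, hc1, hc2, h1] at this ⊢
      linear_combination this
    · have := hC (v 0) (v 1) (v 2) 0 0 1 (by simp [mem_shiftSet_iff])
      simp [taoCoeffOpt, optShift, Equiv.Perm.mul_apply, Equiv.swap_apply_of_ne_of_ne,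
        Equiv.swap_apply_left, Equiv.swap_apply_right, Equiv.symm_swap, hc1, hc2, h1] at this ⊢
      linear_combination this


/-! ## The composition (PROVED, sorry-free) -/

/-- **A → C → D → E → the crux text** (the conclusion is the body of `PerpetualPump.CircuitPump`
verbatim; `CircuitPump_of` below restates it BY NAME). Fix `lam₀ > 1`; A gives `lam`, the legal circuit
and the box data; for every `L'`, C at level `max L' L₀` gives a relative periodic point of the
truncated lattice with flight time in `[Tmin, Tmax]` (by `WindowOK` at `A = x_{ia,0} ∈ [lo ia, hi ia]`);
D turns them into a one-period relative periodic orbit of the full lattice; restricting to `[0, T]`,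
inverting `lam^{1/5}` and using `0 < lo ia ≤ Z_{ia,0}(0)` gives a `OnePeriodWitness`; E unrolls it;
the witness tuple is `⟨lam, _, _, m, coeff, 1, X, IsSym, IsCyc, le_rfl, ODE, DSS, Type I, nontrivial⟩`
(the landed clauses `SolvesODE`/`IsDSS 1`/`IsTypeI`/`IsNontrivial` ARE the crux's clauses, definitionally). -/
theorem circuitPump_of_parts (hA : ClockBox) (hC : CoveringPeriodicPoint) (hD : TruncationLimit)
    (hE : DssExtension) :
    ∀ lam₀ : ℝ, 1 < lam₀ → ∃ lam : ℝ, 1 < lam ∧ lam < lam₀ ∧ ∃ (m : ℕ) (coeff : Fin m → Fin m → Fin m → Option (Fin 3) → ℝ) (k : ℕ) (X : Fin m → ℤ → ℝ → ℝ), let F : Fin m → ℤ → ℝ → ℝ := fun (i : Fin m) (n : ℤ) (t : ℝ) => -(lam ^ ((4 / 5 : ℝ) * n)) * X i n t + ∑ i₁ : Fin m, ∑ i₂ : Fin m, ∑ μ : Option (Fin 3), coeff i₁ i₂ i μ * lam ^ ((n : ℝ) - (if μ = some 2 then 1 else 0)) * X i₁ (n + ((if μ = some 0 then 1 else 0) -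 (if μ = some 2 then 1 else 0))) t * X i₂ (n + ((if μ = some 1 then 1 else 0) - (if μ = some 2 then 1 else 0))) t; (∀ (i₁ i₂ i₃ : Fin m) (μ : Option (Fin 3)), coeff i₁ i₂ i₃ μ = coeff i₂ i₁ i₃ (Option.map (Equiv.swap (0 : Fin 3) 1) μ)) ∧ (∀ (v : Fin 3 → Fin m) (μ : Option (Fin 3)), ∑ σ : Equiv.Perm (Fin 3), coeff (v (σ 0)) (v (σ 1)) (v (σ 2)) (Option.map σ.symm μ) = 0) ∧ 1 ≤ k ∧ (∀ (i : Fin m) (n : ℤ) (t : ℝ), t < 0 → HasDerivAt (X i n) (F i n t) t) ∧ (∀ (i : Fin m) (n : ℤ) (t : ℝ), t < 0 → X i (n + k) (lam ^ (-((4 / 5 : ℝ) * k)) * t) = lam ^ (-((1 / 5 : ℝ) * k)) * X i n t) ∧ (∃ C : ℝ, ∀ (i : Fin m) (n : ℤ) (t : ℝ), t < 0 → lam ^ ((3 / 5 : ℝ) * n) * |X i n t| ≤ C / Real.sqrt (-t)) ∧ (∃ (i : Fin m) (n : ℤ) (t : ℝ), t < 0 ∧ X i n t ≠ 0) := by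
  intro lam₀ hlam₀
  obtain ⟨lam, hlam, hlt, m, coeff, hS, hCy, lo, hi, Q, ia, ip, T₁, T₂, C, Tmin, Tmax, L₀, hip, hL₀, hbox,
    hpos, hwin, hcov⟩ := hA lam₀ hlam₀
  obtain ⟨hT₁c, hT₂c, hTmin, hwinA⟩ := hwin
  have hAmem : lo ia ∈ Icc (lo ia) (hi ia) := ⟨le_rfl, hbox.1 ia⟩
  have hTT : Tmin ≤ Tmax := by
    obtain ⟨h1, h2, h3⟩ := hwinA _ hAmem
    linarith
  have hQ : ∀ n : ℤ, n ≠ 0 → IsCompact (Q n) := fun n hn => (hbox.2.1 n hn).1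
  -- relative periodic points of the truncated lattices, at every level
  have hper : ∀ L' : ℕ, ∃ L : ℕ, L' ≤ L ∧ ∃ (x : Fin m → ℤ → ℝ) (T : ℝ) (Z : Fin m → ℤ → ℝ → ℝ),
      InBox lo hi Q x ∧ T ∈ Icc Tmin Tmax ∧ IsTruncSolOn L lam coeff x Tmax Z ∧
      WBound lam C Tmax Z ∧
      ∀ (i : Fin m) (n : ℤ), |n| ≤ (L : ℤ) → x i n = lam ^ (1 / 5 : ℝ) * Z i (n + 1) T := by
    intro L'
    refine ⟨max L' L₀, le_max_left _ _, ?_⟩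
    obtain ⟨x, T, Z, hxin, -, hTmem, hsol, hwb, hmatch⟩ :=
      hC lam hlam m coeff lo hi Q ia ip T₁ T₂ C Tmin Tmax L₀ (max L' L₀) hip hL₀ (le_max_right _ _) hbox
        ⟨hT₁c, hT₂c, hTmin, hwinA⟩ (hcov _ (le_max_right _ _))
    obtain ⟨h1, h2, h3⟩ := hwinA _ (hxin.1 ia)
    exact ⟨x, T, Z, hxin, ⟨le_trans h1 hTmem.1, le_trans hTmem.2 h3⟩, hsol, hwb, hmatch⟩
  obtain ⟨T, Z, hTmem, hsol, hwb, hin, hmatch⟩ :=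
    hD lam hlam m coeff lo hi Q C Tmin Tmax hTmin hTT hQ hper
  -- the one-period witness of the full lattice
  have hTpos : 0 < T := lt_of_lt_of_le hTmin hTmem.1
  have hlam0 : 0 < lam := by linarith
  have hW : OnePeriodWitness lam m coeff := by
    refine ⟨T, hTpos, Z, ?_, ?_, ⟨C, ?_⟩, ⟨ia, 0, ?_⟩⟩
    · intro i n t ht
      exact (hsol i n t ⟨ht.1, le_trans ht.2 hTmem.2⟩).mono (Icc_subset_Icc le_rfl hTmem.2)
    · intro i n
      rw [hmatch i n, ← mul_assoc, ← Real.rpow_add hlam0]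
      norm_num
    · intro i n t ht
      exact hwb i n t ⟨ht.1, le_trans ht.2 hTmem.2⟩
    · exact ne_of_gt (lt_of_lt_of_le hpos (hin.1 ia).1)
  obtain ⟨X, hode, hdss, htI, hnt⟩ := hE lam hlam m coeff hW
  exact ⟨lam, hlam, hlt, m, coeff, 1, X, hS, hCy, le_rfl, hode, hdss, htI, hnt⟩

/-- **The skeleton theorem**: concludes the route decl `PerpetualPump.CircuitPump` BY NAME from the five
registered stubs (the unique theorem of this file whose conclusion head is the crux constant). -/
theorem CircuitPump_of : Theses.PerpetualPump.CircuitPump :=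
  circuitPump_of_parts clockBox_of_stub
    (coveringPeriodicPoint_of truncatedFlow_of_stub clampCovering_of_stub)
    truncationLimit_of_stub dssExtension_of_stub

end Summit.NavierStokesRegularity.NavierStokesRegularity.Cruxes.CircuitPump.SingularClockGspt
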